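import Summits.FinalStateConjecture.FinalStateConjecture.Theorems.PhotonSphereChannelsDarkFutureDefs
import Summits.FinalStateConjecture.FinalStateConjecture.Theorems.PhotonSphereChannelsChannelsResolveTameDevelopmentsRKerrLocusReduction
import HarnessLib

/-!
# Route PhotonSphereChannels · crux `ChannelsResolveTameDevelopmentsR` (K2R-T2, stmt-FinalStateConjecture-17430) —
# the reduction of stub K♭ `stub_kerrParametersConstantAlong` (line `tame-lasalle-dock`) to UNIQUE PINNING, or to a
# HULL TOPOLOGY with closed Kerr loci + PINNING + parameter uniqueness up to the spin sign

Stub K♭ of the skeleton `Cruxes/ChannelsResolveTameDevelopmentsR/Lines/tame_lasalle_dock.lean` (parameter constancy along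
a generator): for a development as in Φ, a class `(Λ, r₀)` and a horizon generator path `γ`, if EVERY horizon-hull element
along `γ` (`TameHull.IsHorizonHullElement`) has domain of outer communications exactly Kerr with SOME sub-extremal
parameters, then ONE sub-extremal `(M, a)` serves ALL of them. It is stub K `stub_kerrLocusClopen` of the sibling line
`dark-future-exactness` with the window-isolation hypothesis REMOVED and the `∃`-witness replaced by the `∀`-classification,
so neither the window-neighbourhood input (B3) of the landed reduction of K (`…RKerrLocusReduction.lean`) nor window
isolation is needed: the sub-extremal Kerr loci now COVER the based hull `Ω_γ = DarkFuture.HullElt 𝒟 Λ r₀ γ`.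
This file proves K♭'s registered text, VERBATIM as the conclusion, from typed inputs over the landed vocabulary:

* §1 (pure topology, `HullTopology.subset_locus_of_finiteClosedCover`) — a preconnected set covered by the loci of
  finitely many admissible parameters, each relatively closed, and pairwise EQUAL-OR-DISJOINT on the set, lies in every
  admissible locus it meets (the complement of one locus is the finite union of the closed loci disjoint from it, so the
  locus is relatively clopen; Hale 1980, Ch. I §8); `exists_forall_mem_locus_of_finiteClosedCover` — the `∀→∃` shape.
* §2 The one NEW typed input: `KerrParametersUniqueUpToSpinAlong 𝒟 Λ r₀ γ` (UP) — any two sub-extremal parameter pairs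
  realised as exact Kerr d.o.c.s of horizon-hull elements along `γ` agree up to the sign of `a` (intended producers: the
  horizon area along `γ` — area theorem for `horizonOf 𝒟`, `Literature…ChruscielEtAl2001_areaTheorem` is a named fact —
  plus one more horizon invariant, both constant on limits along `γ`). The other inputs are REUSED from the reduction of K:
  `DarkFuture.HullElt`, `HullTopologyAlong` (B1–B3), `KerrParametersPinnedAlong` (B4), `KerrDocParamUniqueOn` (U),
  `KerrDocSpinFlipOn` (S).
* §3 `isKerrDoc_along_of_uniqueUpToSpin` — (UP) + (S) on the elements + the `∀`-classification ⇒ K♭'s conclusion along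
  `γ`; NO topology (take the parameters of any one element; another element's parameters are `(M, ±a)`, and (S) flips).
* §3b Producers of (UP), typed: `invariant_eq_of_isHorizonHullElement_of_tendsto` — an invariant of pointed ends that
  TRANSFERS (is a cluster value of `g ∘ s` on every element along `γ ∘ s`) is constant on `Ω_γ` when `g` converges at `+∞`
  (the pattern of the landed Kretschmann case); `kerrParametersUniqueUpToSpinAlong_of_invariant` — a constant invariant
  that DETERMINES `(M, |a|)` of an exactly-Kerr d.o.c. (e.g. (horizon area, mass)) gives (UP).
* §4 `isKerrDoc_along_of_closedLoci_of_pinned_of_unique` — for ANY preconnected topology on `Ω_γ` in which the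
  sub-extremal Kerr loci are closed ((B1)+(B2) only), (B4) + (U) + (S) + the `∀`-classification ⇒ every realised locus is
  all of `Ω_γ` (§1 with loci `{Z | IsKerrDoc Z.𝓢 Z.E.doc M a}`: (U)+(S) make two loci equal or disjoint); hence K♭ along
  `γ` (`kerrParametersConstant_along_of_closedLoci_of_pinned_of_unique`) and, as a by-product, (UP) itself
  (`kerrParametersUniqueUpToSpinAlong_of_closedLoci_of_pinned_of_unique`) — the topological route FACTORS through §3.
* §5 K♭'s registered text verbatim as conclusion: `kerrParametersConstantAlong_of_uniquePinning` ((UP) for every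
  development as in Φ, class and horizon generator path, and (S) for every end), and
  `kerrParametersConstantAlong_of_closedLoci_of_pinned_of_unique` / `…_of_hullTopology_of_pinned_of_unique`
  ((B1)+(B2) resp. c7's (B1–B3), with (B4), for every development/class/path; (U) and (S) for every end).
  `GeneratorHullExists`, `DevHyp`, `0 < r₀`, admissibility are handed to the producers, not consumed by the logic
  (an empty `Ω_γ` is served by `(M, a) = (1, 0)`).

What is NOT here (the inputs K♭ still owes, reported to the lead in `work/stubs/stub_kerrParametersConstantAlong.md`):
(UP) itself — equivalently an area functional on horizon-hull elements transferring from `horizonOf 𝒟` along `γ` (horizon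
lineage) with the area theorem, plus a second invariant for `a ≠ 0` (the landed Kretschmann pinning
`DarkFuture.schwarzschild_mass_eq_of_horizonLocalised_of_tendsto` covers `a = 0` modulo localisation); or, on the
topological route, the pointed `C²_loc` topology on `Ω_γ` with (B1) and (B2), and the budget (B4); and on both routes the
Kerr-geometry facts (U) (only on the topological route) and (S). No stub of the line is restated as a definition.

References: Hale 1980, Ch. I §8, Lemma 8.1 / Thm. 8.1 [Hale1980]; Dafermos–Luk 2017, §1.2.1 and Conjecture 1
[DafermosLuk2017]; Chruściel–Delay–Galloway–Howard 2001, Thm. 1.1 [ChruscielEtAl2001].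
-/

noncomputable section

-- the operator-norm instance on `E4 →L[ℝ] E4 →L[ℝ] ℝ` needs one more level of pending
-- instance problems than the default (as in `PhotonSphereChannelsTameHullDefs.lean`)
set_option maxSynthPendingDepth 3
-- every `Summit.FinalStateConjecture.FinalStateConjecture.…` name repeats the summit = sub-problem segment (D-0017 layout)
set_option linter.dupNamespace false

open Set Filter Function TopologicalSpace Manifold Bundle
open scoped Topology Manifold ContDiff ENNReal NNReal

/-! ### §1 Pure topology: a preconnected set covered by finitely many closed, pairwise equal-or-disjoint loci -/

namespace Summit.FinalStateConjecture.FinalStateConjecture.Theorems.HullTopology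

variable {H P : Type*} [TopologicalSpace H]

/-- **A preconnected set covered by finitely many relatively closed, pairwise equal-or-disjoint loci lies in every admissible
locus it meets.** Let `Ω ⊆ H` be preconnected, `locus : P → Set H` a family of loci with admissibility predicate `Adm`.
Assume: (closed) every admissible locus is relatively closed in `Ω`; (cover) every point of `Ω` lies in some admissible locus;
(pin) the admissible parameters realised on `Ω` lie in a finite set; (dich) two admissible loci meeting on `Ω` are nested on
`Ω`. Then `Ω ⊆ locus p₀` for every admissible `p₀` whose locus meets `Ω`. Proof: `Ω` is covered by the closure of
`locus p₀ ∩ Ω` and the finite (hence closed) union of the closures of the realised admissible loci NOT meeting `locus p₀` on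
`Ω`; the two are disjoint on `Ω` by (closed) and (dich); preconnectedness (`isPreconnected_iff_subset_of_disjoint_closed`)
puts `Ω` in the first. Hale 1980, Ch. I §8 (a connected set meeting an open-and-closed set lies in it).
[cite: Hale1980, Ch. I §8, Lemma 8.1] -/
theorem subset_locus_of_finiteClosedCover {Ω : Set H} (hΩ : IsPreconnected Ω) (Adm : P → Prop) (locus : P → Set H)
    (hclosed : ∀ p, Adm p → ∀ z ∈ Ω, z ∈ closure (locus p ∩ Ω) → z ∈ locus p)
    (hcover : ∀ z ∈ Ω, ∃ p, Adm p ∧ z ∈ locus p)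
    (hpin : ∃ F : Set P, F.Finite ∧ ∀ p, Adm p → (locus p ∩ Ω).Nonempty → p ∈ F)
    (hdich : ∀ p q, Adm p → Adm q → (locus p ∩ locus q ∩ Ω).Nonempty → locus q ∩ Ω ⊆ locus p)
    {p₀ : P} (hp₀ : Adm p₀) (hne : (locus p₀ ∩ Ω).Nonempty) : Ω ⊆ locus p₀ := by
  obtain ⟨F, hF, hpinF⟩ := hpin
  -- the realised admissible parameters whose locus does not meet `locus p₀` on `Ω`, and the closed set they cover
  set B : Set P := {q ∈ F | Adm q ∧ ¬ (locus p₀ ∩ locus q ∩ Ω).Nonempty}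
  set V : Set H := ⋃ q ∈ B, closure (locus q ∩ Ω)
  have hVc : IsClosed V := (hF.subset (sep_subset _ _)).isClosed_biUnion fun _ _ ↦ isClosed_closure
  have hcov : Ω ⊆ closure (locus p₀ ∩ Ω) ∪ V := by
    intro z hz
    by_cases h : z ∈ locus p₀
    · exact Or.inl (subset_closure ⟨h, hz⟩)
    obtain ⟨q, hq, hzq⟩ := hcover z hz
    refine Or.inr (mem_biUnion (x := q) ⟨hpinF q hq ⟨z, hzq, hz⟩, hq, ?_⟩ (subset_closure ⟨hzq, hz⟩))
    intro hmeet
    exact h (hdich p₀ q hp₀ hq hmeet ⟨hzq, hz⟩)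
  have hdisj : Ω ∩ (closure (locus p₀ ∩ Ω) ∩ V) = ∅ := by
    refine eq_empty_of_forall_notMem fun z ⟨hz, hzp, hzV⟩ ↦ ?_
    obtain ⟨q, hq, hzq⟩ := mem_iUnion₂.1 hzV
    exact hq.2.2 ⟨z, ⟨hclosed p₀ hp₀ z hz hzp, hclosed q hq.2.1 z hz hzq⟩, hz⟩
  rcases isPreconnected_iff_subset_of_disjoint_closed.1 hΩ _ _ isClosed_closure hVc hcov hdisj with h | h
  · exact fun z hz ↦ hclosed p₀ hp₀ z hz (h hz)
  · exfalso
    obtain ⟨z, hzp, hz⟩ := hne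
    obtain ⟨q, hq, hzq⟩ := mem_iUnion₂.1 (h hz)
    exact hq.2.2 ⟨z, ⟨hzp, hclosed q hq.2.1 z hz hzq⟩, hz⟩

/-- **The `∀→∃` shape**: under the hypotheses of `subset_locus_of_finiteClosedCover` (relatively closed admissible loci
covering the preconnected `Ω`, finite pinning, equal-or-disjoint dichotomy), if `Ω` is nonempty then ONE admissible parameter
serves all of `Ω` — the abstract form of stub K♭ `stub_kerrParametersConstantAlong` (`Ω` = horizon-hull elements along a
generator path, `locus (M, a)` = elements with d.o.c. exactly Kerr `(M, a)`, `Adm` = sub-extremality, dichotomy = uniqueness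
of the Kerr parameters of a region up to the spin sign + the spin flip). [cite: Hale1980, Ch. I §8, Lemma 8.1] -/
theorem exists_forall_mem_locus_of_finiteClosedCover {Ω : Set H} (hΩ : IsPreconnected Ω) (Adm : P → Prop)
    (locus : P → Set H) (hclosed : ∀ p, Adm p → ∀ z ∈ Ω, z ∈ closure (locus p ∩ Ω) → z ∈ locus p)
    (hcover : ∀ z ∈ Ω, ∃ p, Adm p ∧ z ∈ locus p)
    (hpin : ∃ F : Set P, F.Finite ∧ ∀ p, Adm p → (locus p ∩ Ω).Nonempty → p ∈ F)
    (hdich : ∀ p q, Adm p → Adm q → (locus p ∩ locus q ∩ Ω).Nonempty → locus q ∩ Ω ⊆ locus p)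
    (hne : Ω.Nonempty) : ∃ p, Adm p ∧ ∀ z ∈ Ω, z ∈ locus p := by
  obtain ⟨z₀, hz₀⟩ := hne
  obtain ⟨p₀, hp₀, hz₀p⟩ := hcover z₀ hz₀
  exact ⟨p₀, hp₀, fun z hz ↦
    subset_locus_of_finiteClosedCover hΩ Adm locus hclosed hcover hpin hdich hp₀ ⟨z₀, hz₀p, hz₀⟩ hz⟩

end Summit.FinalStateConjecture.FinalStateConjecture.Theorems.HullTopology

namespace Summit.FinalStateConjecture.FinalStateConjecture.Theorems.TameLaSalle

open Literature.Geometry.Lorentzian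
open Summit.FinalStateConjecture.FinalStateConjecture.Theorems.TameHull
open Summit.FinalStateConjecture.FinalStateConjecture.Theorems.DarkFuture

section Along

variable {X : Type} [TopologicalSpace X] [ChartedSpace E3 X] [IsManifold (𝓡 3) ∞ X] [ConnectedSpace X]
  {D : InitialDataSet (𝓡 3) X}

/-! ### §2 The typed input (UP): unique pinning of the Kerr parameters along `γ`, up to the spin sign -/

/-- **(UP) `KerrParametersUniqueUpToSpinAlong 𝒟 Λ r₀ γ` — unique pinning along `γ`.** Any two sub-extremal parameter
pairs `(M, a)`, `(M', a')` realised as exact Kerr d.o.c.s of (possibly different) horizon-hull elements along the horizon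
generator path `γ` satisfy `M' = M` and `|a'| = |a|` (intended: the horizon area along `γ` is monotone — area theorem for
`horizonOf 𝒟` — hence constant on limits along `γ`, and so is one further horizon invariant; for an exactly-Kerr d.o.c. the
two determine `(M, |a|)`). Topology-free predicate on `(𝒟, Λ, r₀, γ)`; a sharpening of (B4) `KerrParametersPinnedAlong`
(finitely many realised pairs) to "one realised pair up to the spin sign". [cite: ChruscielEtAl2001, Thm 1.1] -/
def KerrParametersUniqueUpToSpinAlong (𝒟 : VacuumCauchyDevelopment D) [𝒟.metric.HasLeviCivita] (Λ : ℕ → ℝ≥0)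
    (r₀ : ℝ) (γ : ℝ → 𝒟.carrier) : Prop :=
  ∀ (𝓢 : Spacetime.{0} 4) (E : EndDatum 𝓢) (p : 𝓢.carrier), IsHorizonHullElement 𝒟 Λ r₀ γ 𝓢 E p →
    ∀ (𝓢' : Spacetime.{0} 4) (E' : EndDatum 𝓢') (p' : 𝓢'.carrier), IsHorizonHullElement 𝒟 Λ r₀ γ 𝓢' E' p' →
      ∀ M a M' a' : ℝ, 0 < M → |a| < M → 0 < M' → |a'| < M' →
        IsKerrDoc 𝓢 E.doc M a → IsKerrDoc 𝓢' E'.doc M' a' → M' = M ∧ |a'| = |a|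

/-! ### §3 K♭ along `γ` from (UP) and the spin flip (S): no topology -/

/-- **K♭ along `γ` from unique pinning and the spin flip** (registered sub-goal of stub K♭, topology-free): if the realised
sub-extremal Kerr parameters along `γ` are unique up to the spin sign (UP), every horizon-hull element along `γ` admits the
spin flip on its d.o.c. (S), and EVERY horizon-hull element along `γ` has an exactly-Kerr sub-extremal d.o.c., then ONE
sub-extremal `(M, a)` serves them all: the parameters `(M₀, a₀)` of any one element; another element is Kerr `(M₀, ±a₀)` by
(UP) and (S) flips the sign (an empty based hull is served by `(1, 0)`). [cite: DafermosLuk2017, Conjecture 1] -/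
theorem isKerrDoc_along_of_uniqueUpToSpin {𝒟 : VacuumCauchyDevelopment D} [𝒟.metric.HasLeviCivita] {Λ : ℕ → ℝ≥0}
    {r₀ : ℝ} {γ : ℝ → 𝒟.carrier} (huniq : KerrParametersUniqueUpToSpinAlong 𝒟 Λ r₀ γ)
    (hflip : ∀ (𝓢 : Spacetime.{0} 4) (E : EndDatum 𝓢) (p : 𝓢.carrier),
      IsHorizonHullElement 𝒟 Λ r₀ γ 𝓢 E p → KerrDocSpinFlipOn 𝓢 E.doc)
    (hall : ∀ (𝓢 : Spacetime.{0} 4) (E : EndDatum 𝓢) (p : 𝓢.carrier),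
      IsHorizonHullElement 𝒟 Λ r₀ γ 𝓢 E p → ∃ M a : ℝ, 0 < M ∧ |a| < M ∧ IsKerrDoc 𝓢 E.doc M a) :
    ∃ M a : ℝ, 0 < M ∧ |a| < M ∧ ∀ (𝓢 : Spacetime.{0} 4) (E : EndDatum 𝓢) (p : 𝓢.carrier),
      IsHorizonHullElement 𝒟 Λ r₀ γ 𝓢 E p → IsKerrDoc 𝓢 E.doc M a := by
  by_cases hne : ∃ (𝓢 : Spacetime.{0} 4) (E : EndDatum 𝓢) (p : 𝓢.carrier), IsHorizonHullElement 𝒟 Λ r₀ γ 𝓢 E p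
  · obtain ⟨𝓢₀, E₀, p₀, hZ₀⟩ := hne
    obtain ⟨M₀, a₀, hM₀, ha₀, hk₀⟩ := hall 𝓢₀ E₀ p₀ hZ₀
    refine ⟨M₀, a₀, hM₀, ha₀, fun 𝓢 E p hZ ↦ ?_⟩
    obtain ⟨M, a, hM, ha, hk⟩ := hall 𝓢 E p hZ
    obtain ⟨hMM, haa⟩ := huniq 𝓢₀ E₀ p₀ hZ₀ 𝓢 E p hZ M₀ a₀ M a hM₀ ha₀ hM ha hk₀ hk
    subst hMM
    rcases abs_eq_abs.1 haa with h | h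
    · subst h
      exact hk
    · have hk' := hflip 𝓢 E p hZ M a hk
      rw [h, neg_neg] at hk'
      exact hk'
  · push Not at hne
    exact ⟨1, 0, one_pos, by norm_num, fun 𝓢 E p hZ ↦ (hne 𝓢 E p hZ).elim⟩

/-! ### §3b Producers of (UP): a parameter-determining invariant of the elements, constant along `γ` -/

/-- **A transferred invariant is constant on the based hull when its source converges along `γ`** (the pattern of
`DarkFuture.kretschmannAt_eq_of_isHorizonHullElement_of_tendsto`, for an arbitrary Hausdorff-valued invariant `J` of
pointed ends): if for every horizon-hull element `(𝓢, E, p)` along `γ ∘ s` the value `J 𝓢 E p` is a cluster point of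
`g ∘ s` (TRANSFER — e.g. `J` = area of the horizon section through the base point, `g` = area of the sections of
`horizonOf 𝒟` along `γ`: horizon lineage), and `g → c` at `+∞` (e.g. the area theorem), then `J = c` on all of `Ω_γ`.
[cite: Hale1980, Ch. I §8, Lemma 8.1] -/
theorem invariant_eq_of_isHorizonHullElement_of_tendsto {𝒟 : VacuumCauchyDevelopment D} [𝒟.metric.HasLeviCivita]
    {Λ : ℕ → ℝ≥0} {r₀ : ℝ} {γ : ℝ → 𝒟.carrier} {κ : Type*} [TopologicalSpace κ] [T2Space κ]
    (J : ∀ 𝓢 : Spacetime.{0} 4, EndDatum 𝓢 → 𝓢.carrier → κ) {g : ℝ → κ}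
    (htransfer : ∀ (s : ℕ → ℝ) (𝓢 : Spacetime.{0} 4) (E : EndDatum 𝓢) (p : 𝓢.carrier),
      Tendsto s atTop atTop → IsHorizonHullElementAlong 𝒟 Λ r₀ γ s 𝓢 E p → MapClusterPt (J 𝓢 E p) atTop (g ∘ s))
    {c : κ} (hg : Tendsto g atTop (𝓝 c)) :
    ∀ (𝓢 : Spacetime.{0} 4) (E : EndDatum 𝓢) (p : 𝓢.carrier), IsHorizonHullElement 𝒟 Λ r₀ γ 𝓢 E p → J 𝓢 E p = c := by
  rintro 𝓢 E p ⟨s, hs, hZ⟩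
  exact eq_of_nhds_neBot ((MapClusterPt.of_comp hs (htransfer s 𝓢 E p hs hZ)).clusterPt.mono hg)

/-- **(UP) from a parameter-determining invariant constant along `γ`**: if an invariant `J` of pointed ends is constant on
the horizon-hull elements along `γ` (e.g. by `invariant_eq_of_isHorizonHullElement_of_tendsto`), takes the value `Φ M |a|`
on every element whose d.o.c. is exactly Kerr `(M, a)` (sub-extremal), and `Φ` is injective on `{0 ≤ A < M}` (e.g.
`J` = (horizon area, mass), `Φ M A = (8πM(M + √(M² − A²)), M)`), then the realised Kerr parameters along `γ` are unique up
to the spin sign. Pure logic. [cite: ChruscielEtAl2001, Thm 1.1] -/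
theorem kerrParametersUniqueUpToSpinAlong_of_invariant {𝒟 : VacuumCauchyDevelopment D} [𝒟.metric.HasLeviCivita]
    {Λ : ℕ → ℝ≥0} {r₀ : ℝ} {γ : ℝ → 𝒟.carrier} {κ : Type*} (J : ∀ 𝓢 : Spacetime.{0} 4, EndDatum 𝓢 → 𝓢.carrier → κ)
    (Φ : ℝ → ℝ → κ) (c : κ)
    (hconst : ∀ (𝓢 : Spacetime.{0} 4) (E : EndDatum 𝓢) (p : 𝓢.carrier), IsHorizonHullElement 𝒟 Λ r₀ γ 𝓢 E p → J 𝓢 E p = c)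
    (hdet : ∀ (𝓢 : Spacetime.{0} 4) (E : EndDatum 𝓢) (p : 𝓢.carrier), IsHorizonHullElement 𝒟 Λ r₀ γ 𝓢 E p →
      ∀ M a : ℝ, 0 < M → |a| < M → IsKerrDoc 𝓢 E.doc M a → J 𝓢 E p = Φ M |a|)
    (hinj : ∀ M A M' A' : ℝ, 0 < M → 0 ≤ A → A < M → 0 < M' → 0 ≤ A' → A' < M' → Φ M A = Φ M' A' → M' = M ∧ A' = A) :
    KerrParametersUniqueUpToSpinAlong 𝒟 Λ r₀ γ := by
  intro 𝓢 E p hZ 𝓢' E' p' hZ' M a M' a' hM ha hM' ha' hk hk'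
  refine hinj M |a| M' |a'| hM (abs_nonneg a) ha hM' (abs_nonneg a') ha' ?_
  rw [← hdet 𝓢 E p hZ M a hM ha hk, ← hdet 𝓢' E' p' hZ' M' a' hM' ha' hk', hconst 𝓢 E p hZ, hconst 𝓢' E' p' hZ']

/-! ### §4 K♭ along `γ` from (B1)+(B2) hull topology, (B4) pinning, (U) uniqueness and (S) spin flip -/

/-- **Every realised sub-extremal Kerr locus is the whole based hull** (registered sub-goal of stub K♭; (B1)+(B2) only, no
window neighbourhoods, no window isolation): for ANY preconnected topology on `Ω_γ = HullElt 𝒟 Λ r₀ γ` in which every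
sub-extremal Kerr locus `{Z | IsKerrDoc Z.𝓢 Z.E.doc M a}` is closed, if the realised parameters are finitely many (B4), the
Kerr parameters of each element's d.o.c. are unique up to the spin sign (U) and flip (S), and EVERY element has an
exactly-Kerr sub-extremal d.o.c., then every element lies in the locus of any realised sub-extremal `(M₀, a₀)` —
`HullTopology.subset_locus_of_finiteClosedCover` with `Ω = univ`, `P = ℝ × ℝ`; (U)+(S) give the equal-or-disjoint dichotomy.
[cite: Hale1980, Ch. I §8 Thm. 8.1] -/
theorem isKerrDoc_along_of_closedLoci_of_pinned_of_unique {𝒟 : VacuumCauchyDevelopment D} [𝒟.metric.HasLeviCivita]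
    {Λ : ℕ → ℝ≥0} {r₀ : ℝ} {γ : ℝ → 𝒟.carrier} [TopologicalSpace (HullElt 𝒟 Λ r₀ γ)]
    [PreconnectedSpace (HullElt 𝒟 Λ r₀ γ)]
    (hclosed : ∀ M a : ℝ, 0 < M → |a| < M → IsClosed {Z : HullElt 𝒟 Λ r₀ γ | IsKerrDoc Z.𝓢 Z.E.doc M a})
    (hpin : KerrParametersPinnedAlong 𝒟 Λ r₀ γ) (huniq : ∀ Z : HullElt 𝒟 Λ r₀ γ, KerrDocParamUniqueOn Z.𝓢 Z.E.doc)
    (hflip : ∀ Z : HullElt 𝒟 Λ r₀ γ, KerrDocSpinFlipOn Z.𝓢 Z.E.doc)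
    (hall : ∀ Z : HullElt 𝒟 Λ r₀ γ, ∃ M a : ℝ, 0 < M ∧ |a| < M ∧ IsKerrDoc Z.𝓢 Z.E.doc M a)
    {M₀ a₀ : ℝ} (hM₀ : 0 < M₀) (ha₀ : |a₀| < M₀) {Z₀ : HullElt 𝒟 Λ r₀ γ} (hZ₀ : IsKerrDoc Z₀.𝓢 Z₀.E.doc M₀ a₀) :
    ∀ Z : HullElt 𝒟 Λ r₀ γ, IsKerrDoc Z.𝓢 Z.E.doc M₀ a₀ := by
  -- the abstract data
  let Adm : ℝ × ℝ → Prop := fun q ↦ 0 < q.1 ∧ |q.2| < q.1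
  let locus : ℝ × ℝ → Set (HullElt 𝒟 Λ r₀ γ) := fun q ↦ {Z | IsKerrDoc Z.𝓢 Z.E.doc q.1 q.2}
  have hΩ : IsPreconnected (univ : Set (HullElt 𝒟 Λ r₀ γ)) := isPreconnected_univ
  have hsub : (univ : Set (HullElt 𝒟 Λ r₀ γ)) ⊆ locus (M₀, a₀) := by
    refine HullTopology.subset_locus_of_finiteClosedCover hΩ Adm locus ?_ ?_ ?_ ?_ (p₀ := (M₀, a₀)) ⟨hM₀, ha₀⟩
      ⟨Z₀, hZ₀, mem_univ _⟩
    · -- (B2) closed loci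
      intro q hq Z _ hZ
      rw [inter_univ, (hclosed q.1 q.2 hq.1 hq.2).closure_eq] at hZ
      exact hZ
    · -- the `∀`-classification covers `Ω_γ`
      intro Z _
      obtain ⟨M, a, hM, ha, hk⟩ := hall Z
      exact ⟨(M, a), ⟨hM, ha⟩, hk⟩
    · -- (B4) pinning
      obtain ⟨F, hF, hpinF⟩ := hpin
      refine ⟨F, hF, fun q hq ⟨Z, hZ, _⟩ ↦ ?_⟩
      exact hpinF q.1 q.2 hq.1 hq.2 Z.𝓢 Z.E Z.p Z.mem hZ
    · -- (U)+(S): two realised loci meeting are nested (indeed equal)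
      rintro q q' hq hq' ⟨Z, ⟨hZq, hZq'⟩, -⟩ W ⟨hW, -⟩
      obtain ⟨hMM, haa⟩ := huniq Z q.1 q.2 q'.1 q'.2 hq.1 hq.2 hq'.1 hq'.2 hZq hZq'
      change IsKerrDoc W.𝓢 W.E.doc q'.1 q'.2 at hW
      change IsKerrDoc W.𝓢 W.E.doc q.1 q.2
      rw [hMM] at hW
      rcases abs_eq_abs.1 haa with h | h
      · rw [h] at hW
        exact hW
      · have hW' := hflip W q.1 q'.2 hW
        rw [h, neg_neg] at hW'
        exact hW'
  intro Z
  exact hsub (mem_univ Z)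

/-- **K♭ along `γ` from (B1)+(B2), (B4), (U), (S)** (registered sub-goal of stub K♭): for any preconnected topology on
`Ω_γ` with closed sub-extremal Kerr loci, finite pinning, parameter uniqueness up to the spin sign and the spin flip on the
d.o.c. of every horizon-hull element along `γ`, the `∀`-classification gives ONE sub-extremal `(M, a)` for ALL horizon-hull
elements along `γ` (the parameters of any one element, `isKerrDoc_along_of_closedLoci_of_pinned_of_unique`; `(1, 0)` if
`Ω_γ = ∅`). [cite: Hale1980, Ch. I §8 Thm. 8.1] -/
theorem kerrParametersConstant_along_of_closedLoci_of_pinned_of_unique {𝒟 : VacuumCauchyDevelopment D}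
    [𝒟.metric.HasLeviCivita] {Λ : ℕ → ℝ≥0} {r₀ : ℝ} {γ : ℝ → 𝒟.carrier}
    (htop : ∃ τ : TopologicalSpace (HullElt 𝒟 Λ r₀ γ), @PreconnectedSpace (HullElt 𝒟 Λ r₀ γ) τ ∧
      ∀ M a : ℝ, 0 < M → |a| < M → IsClosed[τ] {Z : HullElt 𝒟 Λ r₀ γ | IsKerrDoc Z.𝓢 Z.E.doc M a})
    (hpin : KerrParametersPinnedAlong 𝒟 Λ r₀ γ)
    (huniq : ∀ (𝓢 : Spacetime.{0} 4) (E : EndDatum 𝓢) (p : 𝓢.carrier),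
      IsHorizonHullElement 𝒟 Λ r₀ γ 𝓢 E p → KerrDocParamUniqueOn 𝓢 E.doc)
    (hflip : ∀ (𝓢 : Spacetime.{0} 4) (E : EndDatum 𝓢) (p : 𝓢.carrier),
      IsHorizonHullElement 𝒟 Λ r₀ γ 𝓢 E p → KerrDocSpinFlipOn 𝓢 E.doc)
    (hall : ∀ (𝓢 : Spacetime.{0} 4) (E : EndDatum 𝓢) (p : 𝓢.carrier),
      IsHorizonHullElement 𝒟 Λ r₀ γ 𝓢 E p → ∃ M a : ℝ, 0 < M ∧ |a| < M ∧ IsKerrDoc 𝓢 E.doc M a) :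
    ∃ M a : ℝ, 0 < M ∧ |a| < M ∧ ∀ (𝓢 : Spacetime.{0} 4) (E : EndDatum 𝓢) (p : 𝓢.carrier),
      IsHorizonHullElement 𝒟 Λ r₀ γ 𝓢 E p → IsKerrDoc 𝓢 E.doc M a := by
  by_cases hne : ∃ (𝓢 : Spacetime.{0} 4) (E : EndDatum 𝓢) (p : 𝓢.carrier), IsHorizonHullElement 𝒟 Λ r₀ γ 𝓢 E p
  · obtain ⟨𝓢₀, E₀, p₀, hZ₀⟩ := hne
    obtain ⟨M₀, a₀, hM₀, ha₀, hk₀⟩ := hall 𝓢₀ E₀ p₀ hZ₀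
    obtain ⟨τ, hconn, hclosed⟩ := htop
    letI : TopologicalSpace (HullElt 𝒟 Λ r₀ γ) := τ
    haveI : PreconnectedSpace (HullElt 𝒟 Λ r₀ γ) := hconn
    refine ⟨M₀, a₀, hM₀, ha₀, fun 𝓢 E p hZ ↦ ?_⟩
    exact isKerrDoc_along_of_closedLoci_of_pinned_of_unique hclosed hpin (fun Z ↦ huniq Z.𝓢 Z.E Z.p Z.mem)
      (fun Z ↦ hflip Z.𝓢 Z.E Z.p Z.mem) (fun Z ↦ hall Z.𝓢 Z.E Z.p Z.mem) hM₀ ha₀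
      (Z₀ := ⟨𝓢₀, E₀, p₀, hZ₀⟩) hk₀ ⟨𝓢, E, p, hZ⟩
  · push Not at hne
    exact ⟨1, 0, one_pos, by norm_num, fun 𝓢 E p hZ ↦ (hne 𝓢 E p hZ).elim⟩

/-- **The topological route factors through unique pinning**: under (B1)+(B2), (B4), (U), (S) and the `∀`-classification,
(UP) `KerrParametersUniqueUpToSpinAlong` holds along `γ` (all elements lie in the locus of the first pair by
`isKerrDoc_along_of_closedLoci_of_pinned_of_unique`, and (U) at the second element compares) — so §3 is the weaker set of
hypotheses. [cite: Hale1980, Ch. I §8 Thm. 8.1] -/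
theorem kerrParametersUniqueUpToSpinAlong_of_closedLoci_of_pinned_of_unique {𝒟 : VacuumCauchyDevelopment D}
    [𝒟.metric.HasLeviCivita] {Λ : ℕ → ℝ≥0} {r₀ : ℝ} {γ : ℝ → 𝒟.carrier}
    (htop : ∃ τ : TopologicalSpace (HullElt 𝒟 Λ r₀ γ), @PreconnectedSpace (HullElt 𝒟 Λ r₀ γ) τ ∧
      ∀ M a : ℝ, 0 < M → |a| < M → IsClosed[τ] {Z : HullElt 𝒟 Λ r₀ γ | IsKerrDoc Z.𝓢 Z.E.doc M a})
    (hpin : KerrParametersPinnedAlong 𝒟 Λ r₀ γ)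
    (huniq : ∀ (𝓢 : Spacetime.{0} 4) (E : EndDatum 𝓢) (p : 𝓢.carrier),
      IsHorizonHullElement 𝒟 Λ r₀ γ 𝓢 E p → KerrDocParamUniqueOn 𝓢 E.doc)
    (hflip : ∀ (𝓢 : Spacetime.{0} 4) (E : EndDatum 𝓢) (p : 𝓢.carrier),
      IsHorizonHullElement 𝒟 Λ r₀ γ 𝓢 E p → KerrDocSpinFlipOn 𝓢 E.doc)
    (hall : ∀ (𝓢 : Spacetime.{0} 4) (E : EndDatum 𝓢) (p : 𝓢.carrier),
      IsHorizonHullElement 𝒟 Λ r₀ γ 𝓢 E p → ∃ M a : ℝ, 0 < M ∧ |a| < M ∧ IsKerrDoc 𝓢 E.doc M a) :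
    KerrParametersUniqueUpToSpinAlong 𝒟 Λ r₀ γ := by
  intro 𝓢 E p hZ 𝓢' E' p' hZ' M a M' a' hM ha hM' ha' hk hk'
  obtain ⟨τ, hconn, hclosed⟩ := htop
  letI : TopologicalSpace (HullElt 𝒟 Λ r₀ γ) := τ
  haveI : PreconnectedSpace (HullElt 𝒟 Λ r₀ γ) := hconn
  -- the second element is also Kerr `(M, a)`
  have hk'' : IsKerrDoc 𝓢' E'.doc M a :=
    isKerrDoc_along_of_closedLoci_of_pinned_of_unique hclosed hpin (fun Z ↦ huniq Z.𝓢 Z.E Z.p Z.mem)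
      (fun Z ↦ hflip Z.𝓢 Z.E Z.p Z.mem) (fun Z ↦ hall Z.𝓢 Z.E Z.p Z.mem) hM ha (Z₀ := ⟨𝓢, E, p, hZ⟩) hk
      ⟨𝓢', E', p', hZ'⟩
  exact huniq 𝓢' E' p' hZ' M a M' a' hM ha hM' ha' hk'' hk'

end Along

/-! ### §5 K♭'s registered text, verbatim, from the typed inputs -/

/-- **Reduction of stub K♭ to unique pinning (UP) and the spin flip (S)** (registered sub-goal of stub K♭; K♭'s registered
text VERBATIM as the conclusion; topology-free): if every development as in Φ, every class `(Λ, r₀)` with `0 < r₀` and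
precompact generator hull, and every horizon generator path carry unique pinning (UP) along the path, and every end admits
the spin flip on its d.o.c. (S), then `KerrParametersConstantAlong` holds (`GeneratorHullExists`, `DevHyp`, `0 < r₀`,
admissibility are handed to the producer of (UP), not consumed by the logic). [cite: DafermosLuk2017, Conjecture 1] -/
theorem kerrParametersConstantAlong_of_uniquePinning : (∀ {X : Type} [TopologicalSpace X] [ChartedSpace E3 X] [IsManifold (𝓡 3) ∞ X] [T2Space X] [SecondCountableTopology X] [ConnectedSpace X] {D : InitialDataSet (𝓡 3) X}, D ∈ admissibleVacuumData X → ∀ (𝒟 : VacuumCauchyDevelopment D) [𝒟.metric.HasLeviCivita], DevHyp 𝒟 → ∀ (Λ : ℕ → ℝ≥0) (r₀ : ℝ), 0 < r₀ → GeneratorHullExists 𝒟 Λ r₀ → ∀ γ : ℝ → 𝒟.carrier, IsHorizonPath 𝒟 γ → KerrParametersUniqueUpToSpinAlong 𝒟 Λ r₀ γ) → (∀ (𝓢 : Spacetime.{0} 4) (E : EndDatum 𝓢), KerrDocSpinFlipOn 𝓢 E.doc) → ∀ (X : Type) [TopologicalSpace X] [ChartedSpace E3 X] [IsManifold (𝓡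 3) ∞ X] [T2Space X] [SecondCountableTopology X] [ConnectedSpace X], ∀ D ∈ admissibleVacuumData X, ∀ (𝒟 : VacuumCauchyDevelopment D) [𝒟.metric.HasLeviCivita], DevHyp 𝒟 → ∀ (Λ : ℕ → ℝ≥0) (r₀ : ℝ), 0 < r₀ → GeneratorHullExists 𝒟 Λ r₀ → ∀ γ : ℝ → 𝒟.carrier, IsHorizonPath 𝒟 γ → (∀ (𝓢 : Spacetime.{0} 4) (E : EndDatum 𝓢) (p : 𝓢.carrier), IsHorizonHullElement 𝒟 Λ r₀ γ 𝓢 E p → ∃ M a : ℝ, 0 < M ∧ |a| < M ∧ IsKerrDoc 𝓢 E.doc M a) → ∃ M a : ℝ, 0 < M ∧ |a| < M ∧ ∀ (𝓢 : Spacetime.{0} 4) (E : EndDatum 𝓢) (p : 𝓢.carrier), IsHorizonHullElement 𝒟 Λ r₀ γ 𝓢 E p → IsKerrDoc 𝓢 E.doc M a := by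
  intro hUP hS X _ _ _ _ _ _ D hD 𝒟 _ hdev Λ r₀ hr₀ hgen γ hγ hall
  exact isKerrDoc_along_of_uniqueUpToSpin (hUP hD 𝒟 hdev Λ r₀ hr₀ hgen γ hγ) (fun 𝓢 E _ _ ↦ hS 𝓢 E) hall

/-- **Reduction of stub K♭ to (B1)+(B2) hull topology, (B4) pinning, (U) uniqueness, (S) spin flip** (registered sub-goal
of stub K♭; K♭'s registered text VERBATIM as the conclusion; no window neighbourhoods (B3), no window isolation): if every
development as in Φ, class `(Λ, r₀)` with `0 < r₀` and precompact generator hull, and horizon generator path carry SOME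
preconnected topology on the based hull in which the sub-extremal Kerr loci are closed, together with finite pinning (B4),
and every end has Kerr parameters unique up to the spin sign (U) and the spin flip (S) on its d.o.c., then
`KerrParametersConstantAlong` holds. [cite: Hale1980, Ch. I §8 Thm. 8.1] -/
theorem kerrParametersConstantAlong_of_closedLoci_of_pinned_of_unique : (∀ {X : Type} [TopologicalSpace X] [ChartedSpace E3 X] [IsManifold (𝓡 3) ∞ X] [T2Space X] [SecondCountableTopology X] [ConnectedSpace X] {D : InitialDataSet (𝓡 3) X}, D ∈ admissibleVacuumData X → ∀ (𝒟 : VacuumCauchyDevelopment D) [𝒟.metric.HasLeviCivita], DevHyp 𝒟 → ∀ (Λ : ℕ → ℝ≥0) (r₀ : ℝ), 0 < r₀ → GeneratorHullExists 𝒟 Λ r₀ → ∀ γ : ℝ → 𝒟.carrier, IsHorizonPath 𝒟 γ → (∃ τ : TopologicalSpace (HullElt 𝒟 Λ r₀ γ), @PreconnectedSpace (HullElt 𝒟 Λ r₀ γ) τ ∧ ∀ M a : ℝ, 0 < M → |a| < M → IsClosed[τ] {Z : HullElt 𝒟 Λ r₀ γ | IsKerrDoc Z.𝓢 Z.E.doc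 M a}) ∧ KerrParametersPinnedAlong 𝒟 Λ r₀ γ) → (∀ (𝓢 : Spacetime.{0} 4) (E : EndDatum 𝓢), KerrDocParamUniqueOn 𝓢 E.doc) → (∀ (𝓢 : Spacetime.{0} 4) (E : EndDatum 𝓢), KerrDocSpinFlipOn 𝓢 E.doc) → ∀ (X : Type) [TopologicalSpace X] [ChartedSpace E3 X] [IsManifold (𝓡 3) ∞ X] [T2Space X] [SecondCountableTopology X] [ConnectedSpace X], ∀ D ∈ admissibleVacuumData X, ∀ (𝒟 : VacuumCauchyDevelopment D) [𝒟.metric.HasLeviCivita], DevHyp 𝒟 → ∀ (Λ : ℕ → ℝ≥0) (r₀ : ℝ), 0 < r₀ → GeneratorHullExists 𝒟 Λ r₀ → ∀ γ : ℝ → 𝒟.carrier, IsHorizonPath 𝒟 γ → (∀ (𝓢 : Spacetime.{0} 4) (E : EndDatum 𝓢) (p : 𝓢.carrier), IsHorizonHullElement 𝒟 Λ r₀ γ 𝓢 E p → ∃ M a : ℝ, 0 < M ∧ |a| < M ∧ IsKerrDoc 𝓢 E.doc M a) → ∃ M a : ℝ, 0 < M ∧ |a| < M ∧ ∀ (𝓢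 : Spacetime.{0} 4) (E : EndDatum 𝓢) (p : 𝓢.carrier), IsHorizonHullElement 𝒟 Λ r₀ γ 𝓢 E p → IsKerrDoc 𝓢 E.doc M a := by
  intro hB hU hS X _ _ _ _ _ _ D hD 𝒟 _ hdev Λ r₀ hr₀ hgen γ hγ hall
  obtain ⟨htop, hpin⟩ := hB hD 𝒟 hdev Λ r₀ hr₀ hgen γ hγ
  exact kerrParametersConstant_along_of_closedLoci_of_pinned_of_unique htop hpin (fun 𝓢 E _ _ ↦ hU 𝓢 E)
    (fun 𝓢 E _ _ ↦ hS 𝓢 E) hall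

/-- **Reduction of stub K♭ to c7's (B1–B3) `HullTopologyAlong`, (B4), (U), (S)** (registered sub-goal of stub K♭; K♭'s
registered text VERBATIM as the conclusion): the same with the hull topology of the reduction of K (`HullTopologyAlong`, whose
window-neighbourhood clause (B3) is simply not used) — so ONE producer of `HullTopologyAlong ∧ KerrParametersPinnedAlong`
serves both K (with window isolation) and K♭ (with (U), (S)). [cite: Hale1980, Ch. I §8 Thm. 8.1] -/
theorem kerrParametersConstantAlong_of_hullTopology_of_pinned_of_unique : (∀ {X : Type} [TopologicalSpace X] [ChartedSpace E3 X] [IsManifold (𝓡 3) ∞ X] [T2Space X] [SecondCountableTopology X] [ConnectedSpace X] {D : InitialDataSet (𝓡 3) X}, D ∈ admissibleVacuumData X → ∀ (𝒟 : VacuumCauchyDevelopment D) [𝒟.metric.HasLeviCivita], DevHyp 𝒟 → ∀ (Λ : ℕ → ℝ≥0) (r₀ : ℝ), 0 < r₀ → GeneratorHullExists 𝒟 Λ r₀ → ∀ γ : ℝ → 𝒟.carrier, IsHorizonPath 𝒟 γ → HullTopologyAlong 𝒟 Λ r₀ γ ∧ KerrParametersPinnedAlong 𝒟 Λ r₀ γ)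 → (∀ (𝓢 : Spacetime.{0} 4) (E : EndDatum 𝓢), KerrDocParamUniqueOn 𝓢 E.doc) → (∀ (𝓢 : Spacetime.{0} 4) (E : EndDatum 𝓢), KerrDocSpinFlipOn 𝓢 E.doc) → ∀ (X : Type) [TopologicalSpace X] [ChartedSpace E3 X] [IsManifold (𝓡 3) ∞ X] [T2Space X] [SecondCountableTopology X] [ConnectedSpace X], ∀ D ∈ admissibleVacuumData X, ∀ (𝒟 : VacuumCauchyDevelopment D) [𝒟.metric.HasLeviCivita], DevHyp 𝒟 → ∀ (Λ : ℕ → ℝ≥0) (r₀ : ℝ), 0 < r₀ → GeneratorHullExists 𝒟 Λ r₀ → ∀ γ : ℝ → 𝒟.carrier, IsHorizonPath 𝒟 γ → (∀ (𝓢 : Spacetime.{0} 4) (E : EndDatum 𝓢) (p : 𝓢.carrier), IsHorizonHullElement 𝒟 Λ r₀ γ 𝓢 E p → ∃ M a : ℝ, 0 < M ∧ |a| < M ∧ IsKerrDoc 𝓢 E.doc M a) → ∃ M a : ℝ, 0 < M ∧ |a| < M ∧ ∀ (𝓢 : Spacetime.{0} 4) (E : EndDatum 𝓢) (p : 𝓢.carrier),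 IsHorizonHullElement 𝒟 Λ r₀ γ 𝓢 E p → IsKerrDoc 𝓢 E.doc M a := by
  intro hB hU hS X _ _ _ _ _ _ D hD 𝒟 _ hdev Λ r₀ hr₀ hgen γ hγ hall
  obtain ⟨⟨τ, hconn, hclosed, -⟩, hpin⟩ := hB hD 𝒟 hdev Λ r₀ hr₀ hgen γ hγ
  exact kerrParametersConstant_along_of_closedLoci_of_pinned_of_unique ⟨τ, hconn, hclosed⟩ hpin
    (fun 𝓢 E _ _ ↦ hU 𝓢 E) (fun 𝓢 E _ _ ↦ hS 𝓢 E) hall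

end Summit.FinalStateConjecture.FinalStateConjecture.Theorems.TameLaSalle

end
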